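import Summits.AtomisticToContinuum.Crystallization.Theorems.OverbindingBudgetAffineFarFieldCellSymm

/-!
# OverbindingBudget (2c) — part 27Vb-K(A): the ideal `k`-cell (rhombic dodecahedron) (lens-4 g95; r1673 S3 «27Vb-K ideal cells»)

Support file, pure analysis on `ℝ³ = EuclideanSpace ℝ (Fin 3)`, no atlas.  The REFERENCE CELL of an
fcc (`k`-letter) site in its own cubic frame, and its moment data in the typed interface `IsMomentCell`
of part 27Va-B (`…FarFieldCellTaylor`), obtained through `isMomentCell_of_symmetry` of part 27Vb-S
(`…FarFieldCellSymm`) from THREE SHAPE CONSTANTS of the unit cell: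

* `rdCell h = {x | |x i| + |x j| ≤ 2h (i ≠ j)}` — the closed rhombic dodecahedron of half-width `h`
  about the origin (the Voronoi cell of the fcc lattice with nearest-neighbour distance `ν = 2√2·h`,
  spanned by `2h·(±1,±1,0)` and permutations; circumradius `2h = ν/√2`): closed, bounded, compact,
  convex, star-shaped about `0 ∈ rdCell h`, invariant under the three coordinate flips `flipIso k`
  and the coordinate 3-cycle `cycIso` (hence centrally symmetric), and `rdCell h = h • rdCell 1`
  with the scaling laws for volume and radial moments;
* `HasRadialMoments K V S₂ S₄` — radial shape data of a cell about `0` (volume, exact second radial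
  moment, fourth radial moment bound); the shape constants of `K₀ := rdCell 1` are `|K₀| = 16`,
  `∫_{K₀} ‖x‖² = 24`, `∫_{K₀} ‖x‖⁴ ≤ 656/15` (cube `[-1,1]³` plus six square pyramids; exact values
  `16, 24, 656/15`; discharged separately — part 27Vb-K2 — and consumed here as ONE named hypothesis
  `hC : HasRadialMoments (rdCell 1) 16 24 (656/15)`);
* `isMomentCell_rdCell` — under `hC`, for `0 < h`:
  `IsMomentCell (rdCell h) 0 (h²/2) 0 (3h³) (41/15·h⁴)` (isotropy defect `δ = 0` EXACTLY, by symmetry;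
  `μ₃ = 3h³` from the circumradius, irrelevant downstream since the cell is centrally symmetric);
  in nearest-neighbour units (`h = ν/(2√2)`): `isMomentCell_rdCell_nu` —
  `IsMomentCell (rdCell (ν/(2√2))) 0 (ν²/16) 0 _ (41/960·ν⁴)`, volume `ν³/√2`
  (`volume_rdCell_nu`), i.e. `σ = ν²/16`, `μ₄ = (41/960)ν⁴` as booked (GHCONST-g93 §3, r1664 (B)(i)).

Per SITE the cell data follow by transport (`IsMomentCell.image_moveMap`, `.image_affMap` of parts
27Vb-S(B)/27Vb-A); the hcp (`h`-letter) reference cell is the half-and-mirror image of `rdCell`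
(part 27Vb-K(B), `…FarFieldCellTRD`).
-/

namespace Summit.AtomisticToContinuum.Crystallization.Theorems.OverbindingBudgetAffineFarFieldCellRD

noncomputable section

open MeasureTheory Set
open scoped Pointwise
open Summit.AtomisticToContinuum.Crystallization.Theorems.OverbindingBudgetAffineFarFieldCellTaylor
open Summit.AtomisticToContinuum.Crystallization.Theorems.OverbindingBudgetAffineFarFieldCellSymm

local notation "E3" => EuclideanSpace ℝ (Fin 3)

/-! ### The cell and its elementary geometry -/

/-- support: the closed RHOMBIC DODECAHEDRON of half-width `h` about the origin in the cubic frame,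
`{x | |x i| + |x j| ≤ 2h for i ≠ j}` — the Voronoi cell of the fcc lattice generated by
`2h·(±1,±1,0)` and permutations (nearest-neighbour distance `2√2·h`). -/
def rdCell (h : ℝ) : Set E3 := {x | ∀ i j : Fin 3, i ≠ j → |x i| + |x j| ≤ 2 * h}

/-- Membership in `rdCell h`, by definition. -/
theorem mem_rdCell {h : ℝ} {x : E3} :
    x ∈ rdCell h ↔ ∀ i j : Fin 3, i ≠ j → |x i| + |x j| ≤ 2 * h := Iff.rfl

/-- Membership in `rdCell h` as the three pair conditions. -/
theorem mem_rdCell_iff {h : ℝ} {x : E3} :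
    x ∈ rdCell h ↔ |x 0| + |x 1| ≤ 2 * h ∧ |x 0| + |x 2| ≤ 2 * h ∧ |x 1| + |x 2| ≤ 2 * h := by
  constructor
  · intro hx
    exact ⟨hx 0 1 (by decide), hx 0 2 (by decide), hx 1 2 (by decide)⟩
  · rintro ⟨h01, h02, h12⟩ i j hij
    have h10 : |x 1| + |x 0| ≤ 2 * h := by rw [add_comm]; exact h01
    have h20 : |x 2| + |x 0| ≤ 2 * h := by rw [add_comm]; exact h02
    have h21 : |x 2| + |x 1| ≤ 2 * h := by rw [add_comm]; exact h12
    obtain rfl | rfl | rfl : i = 0 ∨ i = 1 ∨ i = 2 := by fin_cases i <;> simp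
    all_goals obtain rfl | rfl | rfl : j = 0 ∨ j = 1 ∨ j = 2 := by fin_cases j <;> simp
    all_goals first | exact absurd rfl hij | assumption

/-- The origin lies in `rdCell h` for `0 ≤ h`. -/
theorem zero_mem_rdCell {h : ℝ} (hh : 0 ≤ h) : (0 : E3) ∈ rdCell h := by
  intro i j _
  simp only [PiLp.zero_apply, abs_zero, add_zero]
  linarith

/-- Three nonnegative reals with pairwise sums `≤ s`, the third the smallest: sum of squares `≤ s²`. -/
theorem sq_add_sq_add_sq_le {a b c s : ℝ} (ha : 0 ≤ a) (hb : 0 ≤ b) (hc : 0 ≤ c)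
    (hab : a + b ≤ s) (hca : c ≤ a) (hcb : c ≤ b) : a ^ 2 + b ^ 2 + c ^ 2 ≤ s ^ 2 := by
  have h1 : c * c ≤ a * b := mul_le_mul hca hcb hc ha
  have h2 : (a + b) ^ 2 ≤ s ^ 2 := pow_le_pow_left₀ (add_nonneg ha hb) hab 2
  nlinarith [mul_nonneg ha hb]

/-- CIRCUMRADIUS: every point of `rdCell h` has norm `≤ 2h` (attained at the 4-valent vertices
`(±2h, 0, 0)`, …). -/
theorem norm_le_of_mem_rdCell {h : ℝ} (hh : 0 ≤ h) {x : E3} (hx : x ∈ rdCell h) : ‖x‖ ≤ 2 * h := by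
  obtain ⟨h01, h02, h12⟩ := mem_rdCell_iff.1 hx
  have key : |x 0| ^ 2 + |x 1| ^ 2 + |x 2| ^ 2 ≤ (2 * h) ^ 2 := by
    rcases le_total |x 2| |x 0| with h20 | h02'
    · rcases le_total |x 2| |x 1| with h21 | h12'
      · exact sq_add_sq_add_sq_le (abs_nonneg _) (abs_nonneg _) (abs_nonneg _) h01 h20 h21
      · have := sq_add_sq_add_sq_le (abs_nonneg (x 0)) (abs_nonneg (x 2)) (abs_nonneg (x 1)) h02
          (h12'.trans h20) h12'
        linarith
    · rcases le_total |x 0| |x 1| with h01' | h10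
      · have := sq_add_sq_add_sq_le (abs_nonneg (x 1)) (abs_nonneg (x 2)) (abs_nonneg (x 0)) h12
          h01' h02'
        linarith
      · have := sq_add_sq_add_sq_le (abs_nonneg (x 0)) (abs_nonneg (x 2)) (abs_nonneg (x 1)) h02
          h10 (h10.trans h02')
        linarith
  have hn : ‖x‖ ^ 2 = |x 0| ^ 2 + |x 1| ^ 2 + |x 2| ^ 2 := by
    rw [EuclideanSpace.real_norm_sq_eq, Fin.sum_univ_three]
    simp only [sq_abs]
  rw [← hn] at key
  exact (sq_le_sq₀ (norm_nonneg x) (by positivity)).1 key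

/-- `rdCell h` lies in the closed ball of radius `2h` (`= ν/√2` in nearest-neighbour units). -/
theorem rdCell_subset_closedBall {h : ℝ} (hh : 0 ≤ h) : rdCell h ⊆ Metric.closedBall 0 (2 * h) := by
  intro x hx
  rw [mem_closedBall_zero_iff]
  exact norm_le_of_mem_rdCell hh hx

/-- `rdCell h` is closed. -/
theorem isClosed_rdCell (h : ℝ) : IsClosed (rdCell h) := by
  simp only [rdCell, setOf_forall]
  refine isClosed_iInter fun i => isClosed_iInter fun j => isClosed_iInter fun _ => ?_
  exact isClosed_le (((EuclideanSpace.proj i).continuous.abs).add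
    ((EuclideanSpace.proj j).continuous.abs)) continuous_const

/-- `rdCell h` is compact. -/
theorem isCompact_rdCell {h : ℝ} (hh : 0 ≤ h) : IsCompact (rdCell h) :=
  Metric.isCompact_of_isClosed_isBounded (isClosed_rdCell h)
    (Metric.isBounded_closedBall.subset (rdCell_subset_closedBall hh))

/-- `rdCell h` is measurable. -/
theorem measurableSet_rdCell (h : ℝ) : MeasurableSet (rdCell h) := (isClosed_rdCell h).measurableSet

/-- `rdCell h` is convex (an intersection of twelve closed half-spaces). -/
theorem convex_rdCell (h : ℝ) : Convex ℝ (rdCell h) := by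
  intro x hx y hy a b ha hb hab i j hij
  have hx' := hx i j hij
  have hy' := hy i j hij
  simp only [PiLp.add_apply, PiLp.smul_apply, smul_eq_mul]
  have e1 : |a * x i + b * y i| ≤ a * |x i| + b * |y i| := by
    calc |a * x i + b * y i| ≤ |a * x i| + |b * y i| := abs_add_le _ _
      _ = a * |x i| + b * |y i| := by rw [abs_mul, abs_mul, abs_of_nonneg ha, abs_of_nonneg hb]
  have e2 : |a * x j + b * y j| ≤ a * |x j| + b * |y j| := by
    calc |a * x j + b * y j| ≤ |a * x j| + |b * y j| := abs_add_le _ _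
      _ = a * |x j| + b * |y j| := by rw [abs_mul, abs_mul, abs_of_nonneg ha, abs_of_nonneg hb]
  have e3 := mul_le_mul_of_nonneg_left hx' ha
  have e4 := mul_le_mul_of_nonneg_left hy' hb
  calc |a * x i + b * y i| + |a * x j + b * y j|
      ≤ a * (|x i| + |x j|) + b * (|y i| + |y j|) := by linarith
    _ ≤ a * (2 * h) + b * (2 * h) := by linarith
    _ = 2 * h := by rw [← add_mul, hab, one_mul]

/-- `rdCell h` is star-shaped about the origin (`0 ≤ h`). -/
theorem starConvex_rdCell {h : ℝ} (hh : 0 ≤ h) : StarConvex ℝ (0 : E3) (rdCell h) :=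
  (convex_rdCell h).starConvex (zero_mem_rdCell hh)

/-! ### Symmetries: the three coordinate flips and the coordinate 3-cycle -/

/-- A coordinate flip does not change the absolute values of the coordinates. -/
theorem abs_flipIso_apply (k : Fin 3) (v : E3) (i : Fin 3) : |flipIso k v i| = |v i| := by
  rw [flipIso_apply]
  split_ifs <;> simp [abs_neg]

/-- `rdCell h` is invariant (about `0`) under each coordinate flip. -/
theorem rdCell_invariant_flip (h : ℝ) (k : Fin 3) : IsInvariantUnder (rdCell h) 0 (flipIso k) := by
  intro x hx i j hij
  simp only [zero_add, sub_zero, abs_flipIso_apply]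
  exact hx i j hij

/-- `rdCell h` is invariant (about `0`) under the coordinate 3-cycle. -/
theorem rdCell_invariant_cyc (h : ℝ) : IsInvariantUnder (rdCell h) 0 cycIso := by
  intro x hx
  obtain ⟨h01, h02, h12⟩ := mem_rdCell_iff.1 hx
  simp only [zero_add, sub_zero, mem_rdCell_iff, cycIso_apply_zero, cycIso_apply_one,
    cycIso_apply_two]
  exact ⟨by linarith, by linarith, by linarith⟩

/-- `rdCell h` is invariant (about `0`) under the inverse coordinate 3-cycle. -/
theorem rdCell_invariant_cyc_symm (h : ℝ) : IsInvariantUnder (rdCell h) 0 cycIso.symm := by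
  intro x hx
  obtain ⟨h01, h02, h12⟩ := mem_rdCell_iff.1 hx
  simp only [zero_add, sub_zero, mem_rdCell_iff, cycIso_symm_apply_zero, cycIso_symm_apply_one,
    cycIso_symm_apply_two]
  exact ⟨by linarith, by linarith, by linarith⟩

/-- `rdCell h` is centrally symmetric about the origin. -/
theorem isCentrallySymmetric_rdCell (h : ℝ) : IsCentrallySymmetric (rdCell h) 0 :=
  centrallySymmetric_of_flips (rdCell_invariant_flip h)

/-! ### Scaling `rdCell h = h • rdCell 1` -/

/-- `rdCell h` is the `h`-fold dilate of the unit cell `rdCell 1` (`0 < h`). -/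
theorem rdCell_eq_smul {h : ℝ} (hh : 0 < h) : rdCell h = h • rdCell 1 := by
  ext x
  rw [mem_smul_set_iff_inv_smul_mem₀ hh.ne', mem_rdCell_iff, mem_rdCell_iff]
  simp only [PiLp.smul_apply, smul_eq_mul, abs_mul, abs_inv, abs_of_pos hh, mul_one]
  have key : ∀ u v : ℝ, u + v ≤ 2 * h ↔ h⁻¹ * u + h⁻¹ * v ≤ 2 := by
    intro u v
    rw [← mul_add, inv_mul_le_iff₀ hh]
    constructor <;> intro H <;> linarith
  rw [key, key, key]

/-- VOLUME SCALING: `|rdCell h| = h³ · |rdCell 1|`. -/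
theorem volume_rdCell_toReal {h : ℝ} (hh : 0 < h) :
    (volume (rdCell h)).toReal = h ^ 3 * (volume (rdCell 1)).toReal := by
  rw [rdCell_eq_smul hh, Measure.addHaar_smul_of_nonneg volume hh.le, finrank_euclideanSpace_fin,
    ENNReal.toReal_mul, ENNReal.toReal_ofReal (by positivity)]

/-- INTEGRAL SCALING: `∫_{rdCell h} f = h³ · ∫_{rdCell 1} f(h • x)`. -/
theorem setIntegral_rdCell_eq_smul {h : ℝ} (hh : 0 < h) (f : E3 → ℝ) :
    ∫ x in rdCell h, f x = h ^ 3 * ∫ x in rdCell 1, f (h • x) := by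
  have e := Measure.setIntegral_comp_smul_of_pos volume f (rdCell 1) hh
  rw [finrank_euclideanSpace_fin, smul_eq_mul] at e
  rw [rdCell_eq_smul hh, e, ← mul_assoc, mul_inv_cancel₀ (pow_ne_zero 3 hh.ne'), one_mul]

/-- RADIAL MOMENT SCALING: `∫_{rdCell h} ‖x‖ⁿ = h^(n+3) · ∫_{rdCell 1} ‖x‖ⁿ`. -/
theorem moment_rdCell_eq_smul {h : ℝ} (hh : 0 < h) (n : ℕ) :
    ∫ x in rdCell h, ‖x‖ ^ n = h ^ (n + 3) * ∫ x in rdCell 1, ‖x‖ ^ n := by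
  rw [setIntegral_rdCell_eq_smul hh]
  have e : (fun x : E3 => ‖h • x‖ ^ n) = fun x => h ^ n * ‖x‖ ^ n := by
    funext x
    rw [norm_smul, Real.norm_eq_abs, abs_of_pos hh, mul_pow]
  rw [e, integral_const_mul, ← mul_assoc, ← pow_add, add_comm]

/-! ### The shape constants of the unit cell and the moment data -/

/-- support: RADIAL SHAPE DATA of a cell `K ⊆ ℝ³` about the origin — its volume `V`, its EXACT second
radial moment `∫_K ‖x‖² = S₂` and a fourth radial moment bound `∫_K ‖x‖⁴ ≤ S₄`.  Together with the
flip/cycle symmetries this is all `isMomentCell_of_symmetry` consumes.  For the unit rhombic dodecahedron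
`K₀ = rdCell 1` (vertices `(±2,0,0)`…, `(±1,±1,±1)`; `K₀ = [-1,1]³ ∪` six square pyramids of height `1`)
the three SHAPE CONSTANTS are `V = 16`, `S₂ = 24` (so `σ₀ = 8/16 = 1/2` per axis), `S₄ = 656/15` (the exact
value): `HasRadialMoments (rdCell 1) 16 24 (656/15)`, discharged by part 27Vb-K2 (Fubini over the cube and
one pyramid) and consumed below as ONE named hypothesis `hC`. -/
def HasRadialMoments (K : Set E3) (V S₂ S₄ : ℝ) : Prop :=
  (volume K).toReal = V ∧ (∫ x in K, ‖x‖ ^ 2) = S₂ ∧ (∫ x in K, ‖x‖ ^ 4) ≤ S₄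

/-- Constructor for `HasRadialMoments` from its three clauses. -/
theorem HasRadialMoments.intro {K : Set E3} {V S₂ S₄ : ℝ} (hV : (volume K).toReal = V)
    (hS : (∫ x in K, ‖x‖ ^ 2) = S₂) (hF : (∫ x in K, ‖x‖ ^ 4) ≤ S₄) : HasRadialMoments K V S₂ S₄ :=
  ⟨hV, hS, hF⟩

/-- Monotonicity in the fourth-moment bound. -/
theorem HasRadialMoments.mono {K : Set E3} {V S₂ S₄ S₄' : ℝ} (hC : HasRadialMoments K V S₂ S₄)
    (h : S₄ ≤ S₄') : HasRadialMoments K V S₂ S₄' :=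
  ⟨hC.1, hC.2.1, hC.2.2.trans h⟩

/-- Under the shape constants: `|rdCell h| = 16 h³`. -/
theorem volume_rdCell (hC : HasRadialMoments (rdCell 1) 16 24 (656 / 15)) {h : ℝ} (hh : 0 < h) :
    (volume (rdCell h)).toReal = 16 * h ^ 3 := by
  rw [volume_rdCell_toReal hh, hC.1, mul_comm]

/-- Under the shape constants: `∫_{rdCell h} ‖x‖² = 24 h⁵`. -/
theorem second_moment_rdCell (hC : HasRadialMoments (rdCell 1) 16 24 (656 / 15)) {h : ℝ} (hh : 0 < h) :
    ∫ x in rdCell h, ‖x‖ ^ 2 = 24 * h ^ 5 := by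
  rw [moment_rdCell_eq_smul hh 2, hC.2.1, mul_comm]

/-- Under the shape constants: `∫_{rdCell h} ‖x‖⁴ ≤ (656/15) h⁷`. -/
theorem fourth_moment_rdCell_le (hC : HasRadialMoments (rdCell 1) 16 24 (656 / 15)) {h : ℝ} (hh : 0 < h) :
    ∫ x in rdCell h, ‖x‖ ^ 4 ≤ 656 / 15 * h ^ 7 := by
  rw [moment_rdCell_eq_smul hh 4, mul_comm]
  exact mul_le_mul_of_nonneg_right hC.2.2 (by positivity)

/-- Under the shape constants: `∫_{rdCell h} ‖x‖³ ≤ 48 h⁶` (circumradius `2h` times the second moment). -/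
theorem third_moment_rdCell_le (hC : HasRadialMoments (rdCell 1) 16 24 (656 / 15)) {h : ℝ} (hh : 0 < h) :
    ∫ x in rdCell h, ‖x‖ ^ 3 ≤ 48 * h ^ 6 := by
  have hKc := isCompact_rdCell hh.le
  have i3 : IntegrableOn (fun x : E3 => ‖x‖ ^ 3) (rdCell h) :=
    (continuous_norm.pow 3).continuousOn.integrableOn_compact hKc
  have i2 : IntegrableOn (fun x : E3 => 2 * h * ‖x‖ ^ 2) (rdCell h) :=
    (continuous_const.mul (continuous_norm.pow 2)).continuousOn.integrableOn_compact hKc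
  have hle : ∀ x ∈ rdCell h, ‖x‖ ^ 3 ≤ 2 * h * ‖x‖ ^ 2 := by
    intro x hx
    have h1 := norm_le_of_mem_rdCell hh.le hx
    have h2 : 0 ≤ ‖x‖ ^ 2 := by positivity
    calc ‖x‖ ^ 3 = ‖x‖ * ‖x‖ ^ 2 := by ring
      _ ≤ 2 * h * ‖x‖ ^ 2 := mul_le_mul_of_nonneg_right h1 h2
  calc ∫ x in rdCell h, ‖x‖ ^ 3 ≤ ∫ x in rdCell h, 2 * h * ‖x‖ ^ 2 :=
        setIntegral_mono_on i3 i2 (measurableSet_rdCell h) hle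
    _ = 2 * h * (24 * h ^ 5) := by rw [integral_const_mul, second_moment_rdCell hC hh]
    _ = 48 * h ^ 6 := by ring

/-- ★ **The ideal `k`-cell is a moment cell.**  Under the shape constants, for `0 < h`:
`IsMomentCell (rdCell h) 0 (h²/2) 0 (3h³) (41/15·h⁴)` — centroid `0` and EXACT isotropy (`δ = 0`) by the
flip/cycle symmetries (`isMomentCell_of_symmetry`), `σ = h²/2` from `∫‖x‖² = 24h⁵ = 3σ·16h³`,
`μ₃ = 3h³`, `μ₄ = (41/15)h⁴`. -/
theorem isMomentCell_rdCell (hC : HasRadialMoments (rdCell 1) 16 24 (656 / 15)) {h : ℝ} (hh : 0 < h) :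
    IsMomentCell (rdCell h) 0 (h ^ 2 / 2) 0 (3 * h ^ 3) (41 / 15 * h ^ 4) := by
  have hvol := volume_rdCell hC hh
  have hm := isMomentCell_of_symmetry (isCompact_rdCell hh.le) (starConvex_rdCell hh.le)
    (zero_mem_rdCell hh.le) (rdCell_invariant_flip h) (rdCell_invariant_cyc h)
    (rdCell_invariant_cyc_symm h) (σ := h ^ 2 / 2) (δ₀ := 0) (μ₃ := 3 * h ^ 3)
    (μ₄ := 41 / 15 * h ^ 4) le_rfl ?_ ?_ ?_
  · simpa using hm
  · simp only [sub_zero, hvol, second_moment_rdCell hC hh]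
    ring_nf
    simp
  · simp only [sub_zero, hvol]
    calc ∫ x in rdCell h, ‖x‖ ^ 3 ≤ 48 * h ^ 6 := third_moment_rdCell_le hC hh
      _ = 3 * h ^ 3 * (16 * h ^ 3) := by ring
  · simp only [sub_zero, hvol]
    calc ∫ x in rdCell h, ‖x‖ ^ 4 ≤ 656 / 15 * h ^ 7 := fourth_moment_rdCell_le hC hh
      _ = 41 / 15 * h ^ 4 * (16 * h ^ 3) := by ring

/-! ### Nearest-neighbour units: `h = ν/(2√2)` -/

/-- `(2√2)² = 8`. -/
theorem two_mul_sqrt_two_sq : (2 * Real.sqrt 2) ^ 2 = 8 := by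
  rw [mul_pow, Real.sq_sqrt (by norm_num : (0:ℝ) ≤ 2)]; norm_num

/-- ★ The ideal `k`-cell at nearest-neighbour distance `ν`: `σ = ν²/16`, `δ = 0`, `μ₄ = (41/960)ν⁴`. -/
theorem isMomentCell_rdCell_nu (hC : HasRadialMoments (rdCell 1) 16 24 (656 / 15)) {ν : ℝ} (hν : 0 < ν) :
    IsMomentCell (rdCell (ν / (2 * Real.sqrt 2))) 0 (ν ^ 2 / 16) 0
      (3 * (ν / (2 * Real.sqrt 2)) ^ 3) (41 / 960 * ν ^ 4) := by
  have hs : 0 < 2 * Real.sqrt 2 := by positivity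
  have hh : 0 < ν / (2 * Real.sqrt 2) := div_pos hν hs
  have e2 : (ν / (2 * Real.sqrt 2)) ^ 2 = ν ^ 2 / 8 := by rw [div_pow, two_mul_sqrt_two_sq]
  have e1 : ν ^ 2 / 16 = (ν / (2 * Real.sqrt 2)) ^ 2 / 2 := by rw [e2]; ring
  have e4' : (ν / (2 * Real.sqrt 2)) ^ 4 = ν ^ 4 / 64 := by
    rw [show (ν / (2 * Real.sqrt 2)) ^ 4 = ((ν / (2 * Real.sqrt 2)) ^ 2) ^ 2 by ring, e2]; ring
  have e4 : 41 / 960 * ν ^ 4 = 41 / 15 * (ν / (2 * Real.sqrt 2)) ^ 4 := by rw [e4']; ring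
  rw [e1, e4]
  exact isMomentCell_rdCell hC hh

/-- The ideal `k`-cell at nearest-neighbour distance `ν` has volume `ν³/√2` (under the shape constants). -/
theorem volume_rdCell_nu (hC : HasRadialMoments (rdCell 1) 16 24 (656 / 15)) {ν : ℝ} (hν : 0 < ν) :
    (volume (rdCell (ν / (2 * Real.sqrt 2)))).toReal = ν ^ 3 / Real.sqrt 2 := by
  have hs2 : 0 < Real.sqrt 2 := by positivity
  have hh : 0 < ν / (2 * Real.sqrt 2) := by positivity
  rw [volume_rdCell hC hh, div_pow, mul_pow]
  have e3 : Real.sqrt 2 ^ 3 = 2 * Real.sqrt 2 := by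
    rw [pow_succ, Real.sq_sqrt (by norm_num : (0:ℝ) ≤ 2)]
  rw [e3]
  field_simp
  ring

/-- The ideal `k`-cell at nearest-neighbour distance `ν` lies in the closed ball of radius `ν/√2`. -/
theorem rdCell_nu_subset_closedBall {ν : ℝ} (hν : 0 ≤ ν) :
    rdCell (ν / (2 * Real.sqrt 2)) ⊆ Metric.closedBall 0 (ν / Real.sqrt 2) := by
  have hs2 : 0 < Real.sqrt 2 := by positivity
  have hh : 0 ≤ ν / (2 * Real.sqrt 2) := by positivity
  have e : 2 * (ν / (2 * Real.sqrt 2)) = ν / Real.sqrt 2 := by field_simp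
  rw [← e]
  exact rdCell_subset_closedBall hh

end

end Summit.AtomisticToContinuum.Crystallization.Theorems.OverbindingBudgetAffineFarFieldCellRD
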